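import Summits.Parity.GeneralizedHardyLittlewood.Theorems.FordMaynardNoSieveConst0164NegWitness0164DefsTable

/-!
# Route `FordMaynardNoSieveConst0164`, crux `NegWitness0164` (stmt-Parity-19102), line `birth`,
# stub `stub_tweakNeg0164`: symmetry of the α-families in the two frozen cells

Helper file (def-free).  The hypothesis of `negWitness0164_of_family_bounds[_scaled]` (`…CruxOfFamilies`) runs over
ORDERED pairs of frozen cells `(j₀, j₁)` with `j₀ + j₁ ≤ 10` (66 pairs).  Since the table `lpCoeff0164` is invariant
under permuting its five indices, swapping the two frozen cells does not change the pinned coefficients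
(`lpCoeff0164_append_swap`), so every pinned family sum is symmetric in `(j₀, j₁)` (`family_sum_swap_0164`) and only the
36 pairs with `j₀ ≤ j₁` need a certificate (`family_bounds_of_le_0164`).  K. Ford, J. Maynard, arXiv:2407.14368, §8.

References: [FordMaynard2024PrimeSieves] arXiv:2407.14368, §8 (proof of Theorem 2.7 (c)); folklore.
-/

noncomputable section

open Finset
open scoped Classical

namespace Summit.Parity.GeneralizedHardyLittlewood.FordMaynardNoSieveConst0164NegWitness0164

/-- Appending the swapped pair is appending the pair and then swapping the last two coordinates. [folklore] -/
theorem append_pair_swap (τ : Fin 3 → Fin 24) (j₀ j₁ : Fin 24) :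
    (Fin.append τ ![j₁, j₀] : Fin 5 → Fin 24) = Fin.append τ ![j₀, j₁] ∘ ⇑(Equiv.swap (3 : Fin 5) 4) := by
  funext k
  simp only [Function.comp_apply]
  refine Fin.addCases (m := 3) (n := 2) (fun i => ?_) (fun i => ?_) k
  · have h3 : (Fin.castAdd 2 i : Fin 5) ≠ 3 := by
      intro h; have := congrArg Fin.val h; simp at this; omega
    have h4 : (Fin.castAdd 2 i : Fin 5) ≠ 4 := by
      intro h; have := congrArg Fin.val h; simp at this; omega
    rw [Equiv.swap_apply_of_ne_of_ne h3 h4, Fin.append_left, Fin.append_left]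
  · have hsw : ∀ i : Fin 2, (Equiv.swap (3 : Fin 5) 4) (Fin.natAdd 3 i) = Fin.natAdd 3 (Equiv.swap (0 : Fin 2) 1 i) := by
      decide
    rw [hsw, Fin.append_right, Fin.append_right]
    fin_cases i <;> rfl

/-- **The pinned coefficients are symmetric in the frozen pair.** [folklore] -/
theorem lpCoeff0164_append_swap (τ : Fin 3 → Fin 24) (j₀ j₁ : Fin 24) :
    lpCoeff0164 (Fin.append τ ![j₁, j₀]) = lpCoeff0164 (Fin.append τ ![j₀, j₁]) := by
  rw [append_pair_swap, lpCoeff0164_comp_perm]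

/-- **Family sums are symmetric in the frozen pair**: for any weight `W`,
`Σ_τ lpCoeff0164(τ,j₁,j₀)·W(τ) = Σ_τ lpCoeff0164(τ,j₀,j₁)·W(τ)`. [folklore] -/
theorem family_sum_swap_0164 (j₀ j₁ : Fin 24) (W : (Fin 3 → Fin 24) → ℝ) :
    ∑ τ : Fin 3 → Fin 24, lpCoeff0164 (Fin.append τ ![j₁, j₀]) * W τ =
      ∑ τ : Fin 3 → Fin 24, lpCoeff0164 (Fin.append τ ![j₀, j₁]) * W τ := by
  refine Finset.sum_congr rfl fun τ _ => ?_
  rw [lpCoeff0164_append_swap]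

/-- **From the 36 unordered families to the 66 ordered ones.** If a family statement `P j α` (any predicate that sees `j`
only through a pinned sum `Σ_τ lpCoeff0164(τ,j)·W(α,τ)` and through `j₀ + j₁`) holds for all `j₀ ≤ j₁`, it holds for
all ordered pairs: here in the concrete form used by `negWitness0164_of_family_bounds_scaled` — a bound
`S(j, α) ≤ R α` for `S(j,α) = α/6 · Σ_τ lpCoeff0164(Fin.append τ j) · W α τ`. [folklore] -/
theorem family_bounds_of_le_0164 (W : ℝ → (Fin 3 → Fin 24) → ℝ) (R : ℝ → ℝ) (lo hi : ℕ → ℝ)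
    (h : ∀ j : Fin 2 → Fin 24, (j 0 : ℕ) ≤ (j 1 : ℕ) → (j 0 : ℕ) + (j 1 : ℕ) ≤ 10 → ∀ α : ℝ, 1 / 2 ≤ α →
      lo ((j 0 : ℕ) + (j 1 : ℕ)) ≤ α → α ≤ hi ((j 0 : ℕ) + (j 1 : ℕ)) →
      α / 6 * ∑ τ : Fin 3 → Fin 24, lpCoeff0164 (Fin.append τ j) * W α τ ≤ R α) :
    ∀ j : Fin 2 → Fin 24, (j 0 : ℕ) + (j 1 : ℕ) ≤ 10 → ∀ α : ℝ, 1 / 2 ≤ α →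
      lo ((j 0 : ℕ) + (j 1 : ℕ)) ≤ α → α ≤ hi ((j 0 : ℕ) + (j 1 : ℕ)) →
      α / 6 * ∑ τ : Fin 3 → Fin 24, lpCoeff0164 (Fin.append τ j) * W α τ ≤ R α := by
  intro j hj α h1 h2 h3
  rcases le_total (j 0 : ℕ) (j 1 : ℕ) with hle | hle
  · exact h j hle hj α h1 h2 h3
  · -- swap the frozen pair
    have e0 : ((![j 1, j 0] : Fin 2 → Fin 24) 0) = j 1 := rfl
    have e1 : ((![j 1, j 0] : Fin 2 → Fin 24) 1) = j 0 := rfl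
    have hsw := h ![j 1, j 0] (by rw [e0, e1]; exact hle) (by rw [e0, e1]; omega) α h1
      (by rw [e0, e1, Nat.add_comm]; exact h2) (by rw [e0, e1, Nat.add_comm]; exact h3)
    rw [family_sum_swap_0164] at hsw
    have hj' : j = ![j 0, j 1] := by
      funext i; fin_cases i <;> rfl
    rw [hj']
    exact hsw

end Summit.Parity.GeneralizedHardyLittlewood.FordMaynardNoSieveConst0164NegWitness0164

end
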